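import Mathlib
import Summits.Ventures.PercRepro2.Defs
import Summits.Ventures.PercRepro2.Harris
import Summits.Ventures.PercRepro2.Graph
import Summits.Ventures.PercRepro2.Events
import Summits.Ventures.PercRepro2.Induced
import Summits.Ventures.PercRepro2.SideCluster
import Summits.Ventures.PercRepro2.HullTree
import Summits.Ventures.PercRepro2.ForestCluster
import Summits.Ventures.PercRepro2.CactusDefs
import Summits.Ventures.PercRepro2.CactusCluster
import Summits.Ventures.PercRepro2.CRFKG
import Summits.Ventures.PercRepro2.CRClusterLaw

/-!
# The three-event inequality (T) for log-supermodular laws, and for the cluster laws of forests and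
triangular cacti (blind cell PercRepro2, mine-a g40; MINE-A.md §95.6)

(T_h), the pendant limit of the cell's (XOR) (MINE-A.md §95.6): for a root `s`, a vertex `h`,
`Q = {h ∈ C_s}` and up-sets `U = {C_s ∈ 𝓤}`, `e = {C_s ∈ 𝓥}` of the cluster of `s`,

  `P(Q ∩ U) · P(e) + P(U) · P(Q ∩ e) ≤ P(Q ∩ U ∩ e) + P(Q) · P(U ∩ e)`

(⟺ `E[(1_U − P(U))(1_e − P(e)) ∣ h ∈ C_s] + Cov(U, e) ≥ 0`).  On a general graph it is the lane's
candidate of record (weight adversary 0 / 2,472); its content is that `Cov(U, e ∣ h ∈ C_s)` may be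
negative for the cluster law.  THIS FILE proves it wherever the cluster law is log-supermodular:

* `t_principal` (Mathlib + `CRFKG` only): for a nonnegative log-supermodular weight `μ` on the
  subsets of a finite `V`, a point `h`, and monotone `u, v : Finset V → [0, 1]`, with the fibres
  `{S ∩ {h} = {h}}` (`h ∈ S`) and `{S ∩ {h} = ∅}` (`h ∉ S`) of `CRFKG`:
  `(Σ_{h∈S} μu)(Σ μv) + (Σ μu)(Σ_{h∈S} μv) ≤ (Σ_{h∈S} μuv)(Σ μ) + (Σ_{h∈S} μ)(Σ μuv)`.
  Proof: both fibres are FKG (`CRFKG.fibre_fkg`), the fibre `h ∈ S` dominates the fibre `h ∉ S`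
  in Holley's sense (`CRFKG.fm_mul_lam_le`), and with `a = Σ_{h∈S} μ`, `b = Σ_{h∉S} μ`,
  `U₁, V₁, M₁` / `U₀, V₀, M₀` the fibre sums of `μu, μv, μuv`:
  `RHS − LHS = 2(aM₁ − U₁V₁) + W`, `W := bM₁ + aM₀ − U₁V₀ − U₀V₁`, where
  `ab·W ≥ b²U₁V₁ + a²U₀V₀ − abU₁V₀ − abU₀V₁ = (bU₁ − aU₀)(bV₁ − aV₀) ≥ 0`.
* `t_of_clusterLaw_lsm` / `t_of_clusterLogSupermod`: the percolation statement whenever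
  `S ↦ P(C_s = S)` satisfies the FKG lattice condition (the cell's `ClusterLogSupermod`);
* `t_of_isForest`, `t_of_isCactusFrom`: **(T_h) on every forest and every triangular cactus**, by
  mine-c's `ForestCluster.clusterLogSupermod_of_isForest` / `Cactus.clusterLogSupermod_of_isCactusFrom`.

No definition; one seat.
-/

namespace Summit.Ventures.PercRepro2

namespace TFKG

open Finset

section Lattice

variable {V : Type*} [Fintype V] [DecidableEq V] {K : Type*} [Field K] [LinearOrder K]
  [IsStrictOrderedRing K]

omit [Fintype V] in
/-- `S ∩ {h} = {h} ↔ h ∈ S`. -/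
lemma inter_singleton_eq_singleton_iff (S : Finset V) (h : V) : S ∩ {h} = {h} ↔ h ∈ S := by
  constructor
  · intro hS
    have : h ∈ S ∩ {h} := by rw [hS]; exact mem_singleton_self h
    exact (mem_inter.1 this).1
  · intro hS; exact inter_singleton_of_mem hS

omit [Fintype V] in
/-- `S ∩ {h} = ∅ ↔ h ∉ S`. -/
lemma inter_singleton_eq_empty_iff (S : Finset V) (h : V) : S ∩ {h} = ∅ ↔ h ∉ S := by
  constructor
  · intro hS hh
    have : h ∈ S ∩ {h} := mem_inter.2 ⟨hh, mem_singleton_self h⟩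
    rw [hS] at this; exact notMem_empty h this
  · intro hS; exact inter_singleton_of_notMem hS

omit [LinearOrder K] [IsStrictOrderedRing K] in
/-- A sum over all subsets splits into the two fibres `h ∈ S` and `h ∉ S`. -/
lemma sum_split (f : Finset V → K) (h : V) :
    ∑ S, f S = (∑ S ∈ univ.filter (fun S => S ∩ {h} = {h}), f S)
      + ∑ S ∈ univ.filter (fun S => S ∩ {h} = ∅), f S := by
  rw [← sum_filter_add_sum_filter_not univ (fun S => S ∩ {h} = {h}) f]
  congr 1
  refine sum_congr (filter_congr fun S _ => ?_) fun _ _ => rfl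
  rw [inter_singleton_eq_singleton_iff, inter_singleton_eq_empty_iff]

variable {μ : Finset V → K} {u v : Finset V → K}

/-- **(T) for log-supermodular laws with a principal `Q = {h ∈ S}`.** -/
theorem t_principal (hμ0 : ∀ S, 0 ≤ μ S) (hlsm : ∀ S T, μ S * μ T ≤ μ (S ∩ T) * μ (S ∪ T))
    (hu0 : ∀ S, 0 ≤ u S) (hu1 : ∀ S, u S ≤ 1) (humono : ∀ S T, S ⊆ T → u S ≤ u T)
    (hv0 : ∀ S, 0 ≤ v S) (hv1 : ∀ S, v S ≤ 1) (hvmono : ∀ S T, S ⊆ T → v S ≤ v T) (h : V) :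
    (∑ S ∈ univ.filter (fun S => S ∩ {h} = {h}), μ S * u S) * (∑ S, μ S * v S)
        + (∑ S, μ S * u S) * (∑ S ∈ univ.filter (fun S => S ∩ {h} = {h}), μ S * v S)
      ≤ (∑ S ∈ univ.filter (fun S => S ∩ {h} = {h}), μ S * (u S * v S)) * (∑ S, μ S)
        + (∑ S ∈ univ.filter (fun S => S ∩ {h} = {h}), μ S) * (∑ S, μ S * (u S * v S)) := by
  -- the fibre sums
  set a := ∑ S ∈ univ.filter (fun S => S ∩ {h} = {h}), μ S with ha
  set b := ∑ S ∈ univ.filter (fun S => S ∩ {h} = ∅), μ S with hb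
  set U₁ := ∑ S ∈ univ.filter (fun S => S ∩ {h} = {h}), μ S * u S with hU₁
  set U₀ := ∑ S ∈ univ.filter (fun S => S ∩ {h} = ∅), μ S * u S with hU₀
  set V₁ := ∑ S ∈ univ.filter (fun S => S ∩ {h} = {h}), μ S * v S with hV₁
  set V₀ := ∑ S ∈ univ.filter (fun S => S ∩ {h} = ∅), μ S * v S with hV₀
  set M₁ := ∑ S ∈ univ.filter (fun S => S ∩ {h} = {h}), μ S * (u S * v S) with hM₁
  set M₀ := ∑ S ∈ univ.filter (fun S => S ∩ {h} = ∅), μ S * (u S * v S) with hM₀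
  rw [sum_split μ h, sum_split (fun S => μ S * u S) h, sum_split (fun S => μ S * v S) h,
    sum_split (fun S => μ S * (u S * v S)) h]
  -- nonnegativity and the bounds by the fibre masses
  have ha0 : 0 ≤ a := sum_nonneg fun S _ => hμ0 S
  have hb0 : 0 ≤ b := sum_nonneg fun S _ => hμ0 S
  have hU₁0 : 0 ≤ U₁ := sum_nonneg fun S _ => mul_nonneg (hμ0 S) (hu0 S)
  have hU₀0 : 0 ≤ U₀ := sum_nonneg fun S _ => mul_nonneg (hμ0 S) (hu0 S)
  have hV₁0 : 0 ≤ V₁ := sum_nonneg fun S _ => mul_nonneg (hμ0 S) (hv0 S)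
  have hV₀0 : 0 ≤ V₀ := sum_nonneg fun S _ => mul_nonneg (hμ0 S) (hv0 S)
  have hM₁0 : 0 ≤ M₁ := sum_nonneg fun S _ => mul_nonneg (hμ0 S) (mul_nonneg (hu0 S) (hv0 S))
  have hM₀0 : 0 ≤ M₀ := sum_nonneg fun S _ => mul_nonneg (hμ0 S) (mul_nonneg (hu0 S) (hv0 S))
  have hU₁a : U₁ ≤ a := sum_le_sum fun S _ => mul_le_of_le_one_right (hμ0 S) (hu1 S)
  have hV₁a : V₁ ≤ a := sum_le_sum fun S _ => mul_le_of_le_one_right (hμ0 S) (hv1 S)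
  have hM₁a : M₁ ≤ a := sum_le_sum fun S _ =>
    mul_le_of_le_one_right (hμ0 S) (mul_le_one₀ (hu1 S) (hv0 S) (hv1 S))
  have hU₀b : U₀ ≤ b := sum_le_sum fun S _ => mul_le_of_le_one_right (hμ0 S) (hu1 S)
  have hV₀b : V₀ ≤ b := sum_le_sum fun S _ => mul_le_of_le_one_right (hμ0 S) (hv1 S)
  have hM₀b : M₀ ≤ b := sum_le_sum fun S _ =>
    mul_le_of_le_one_right (hμ0 S) (mul_le_one₀ (hu1 S) (hv0 S) (hv1 S))
  -- fibre FKG on both fibres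
  have hf1 : U₁ * V₁ ≤ a * M₁ :=
    CRFKG.fibre_fkg (X := {h}) hμ0 hlsm hu0 humono hv0 hvmono {h}
  have hf0 : U₀ * V₀ ≤ b * M₀ :=
    CRFKG.fibre_fkg (X := {h}) hμ0 hlsm hu0 humono hv0 hvmono ∅
  -- Holley: the fibre `h ∈ S` dominates the fibre `h ∉ S`
  have hhu : U₀ * a ≤ b * U₁ := by
    have := CRFKG.fm_mul_lam_le (X := {h}) hμ0 hlsm hu0 humono ∅ {h}
    simpa only [empty_inter, empty_union] using this
  have hhv : V₀ * a ≤ b * V₁ := by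
    have := CRFKG.fm_mul_lam_le (X := {h}) hμ0 hlsm hv0 hvmono ∅ {h}
    simpa only [empty_inter, empty_union] using this
  -- the cross term `W`
  have hW : 0 ≤ b * M₁ + a * M₀ - U₁ * V₀ - U₀ * V₁ := by
    rcases ha0.lt_or_eq with hapos | hazero
    · rcases hb0.lt_or_eq with hbpos | hbzero
      · have hab : 0 < a * b := mul_pos hapos hbpos
        have h1 : b ^ 2 * (U₁ * V₁) ≤ b ^ 2 * (a * M₁) :=
          mul_le_mul_of_nonneg_left hf1 (sq_nonneg b)
        have h2 : a ^ 2 * (U₀ * V₀) ≤ a ^ 2 * (b * M₀) :=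
          mul_le_mul_of_nonneg_left hf0 (sq_nonneg a)
        have h3 : 0 ≤ (b * U₁ - U₀ * a) * (b * V₁ - V₀ * a) :=
          mul_nonneg (sub_nonneg.2 hhu) (sub_nonneg.2 hhv)
        have h4 : a * b * 0 ≤ a * b * (b * M₁ + a * M₀ - U₁ * V₀ - U₀ * V₁) := by
          nlinarith [h1, h2, h3]
        exact le_of_mul_le_mul_left h4 hab
      · -- `b = 0`: the fibre `h ∉ S` is empty
        have hU₀ : U₀ = 0 := le_antisymm (hbzero ▸ hU₀b) hU₀0
        have hV₀ : V₀ = 0 := le_antisymm (hbzero ▸ hV₀b) hV₀0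
        have hM₀ : M₀ = 0 := le_antisymm (hbzero ▸ hM₀b) hM₀0
        rw [← hbzero, hU₀, hV₀, hM₀]; ring_nf; exact le_refl 0
    · -- `a = 0`: the fibre `h ∈ S` is empty
      have hU₁ : U₁ = 0 := le_antisymm (hazero ▸ hU₁a) hU₁0
      have hV₁ : V₁ = 0 := le_antisymm (hazero ▸ hV₁a) hV₁0
      have hM₁ : M₁ = 0 := le_antisymm (hazero ▸ hM₁a) hM₁0
      rw [← hazero, hU₁, hV₁, hM₁]; ring_nf; exact le_refl 0
  -- assemble: `RHS − LHS = 2 (a M₁ − U₁ V₁) + W`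
  have key : M₁ * (a + b) + a * (M₁ + M₀) - (U₁ * (V₁ + V₀) + (U₁ + U₀) * V₁)
      = 2 * (a * M₁ - U₁ * V₁) + (b * M₁ + a * M₀ - U₁ * V₀ - U₀ * V₁) := by ring
  linarith [key, hf1, hW]

end Lattice

section Percolation

variable {V : Type*} {E : Type*} [Fintype V] [DecidableEq V] [Fintype E] [DecidableEq E]
  {K : Type*} [Field K] [LinearOrder K] [IsStrictOrderedRing K]

/-- **(T_h) under a log-supermodular cluster law**: if `S ↦ P(C_s = S)` satisfies the FKG lattice
condition then `P(Q ∩ U)·P(e) + P(U)·P(Q ∩ e) ≤ P(Q ∩ U ∩ e) + P(Q)·P(U ∩ e)` for `Q = {h ∈ C_s}`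
and up-sets `𝓤, 𝓥`. -/
theorem t_of_clusterLaw_lsm (ends : E → Sym2 V) (s h : V) (p : E → K) (hp : IsProbVec p)
    {𝓤 𝓥 : Set (Set V)} (h𝓤 : IsUpperSet 𝓤) (h𝓥 : IsUpperSet 𝓥)
    (hlsm : ∀ S T : Finset V,
      prob p {ω | cluster ends ω s = (S : Set V)} * prob p {ω | cluster ends ω s = (T : Set V)} ≤
        prob p {ω | cluster ends ω s = ((S ∩ T : Finset V) : Set V)} *
          prob p {ω | cluster ends ω s = ((S ∪ T : Finset V) : Set V)}) :
    let Q := clusterInEvent ends s {T : Set V | h ∈ T}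
    let U := clusterInEvent ends s 𝓤
    let e := clusterInEvent ends s 𝓥
    prob p (Q ∩ U) * prob p e + prob p U * prob p (Q ∩ e) ≤
      prob p (Q ∩ U ∩ e) + prob p Q * prob p (U ∩ e) := by
  intro Q U e
  classical
  set w : Finset V → K := fun S => prob p {ω | cluster ends ω s = (S : Set V)} with hw
  set u : Finset V → K := fun S => if ((S : Set V) ∈ 𝓤) then 1 else 0 with hu
  set v : Finset V → K := fun S => if ((S : Set V) ∈ 𝓥) then 1 else 0 with hv
  set q : Finset V → K := fun S => if ((S : Set V) ∈ {T : Set V | h ∈ T}) then 1 else 0 with hq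
  have hw0 : ∀ S, 0 ≤ w S := fun S => prob_nonneg hp _
  have hu0 : ∀ S, 0 ≤ u S := fun S => by simp only [hu]; split_ifs <;> norm_num
  have hu1 : ∀ S, u S ≤ 1 := fun S => by simp only [hu]; split_ifs <;> norm_num
  have hv0 : ∀ S, 0 ≤ v S := fun S => by simp only [hv]; split_ifs <;> norm_num
  have hv1 : ∀ S, v S ≤ 1 := fun S => by simp only [hv]; split_ifs <;> norm_num
  have humono : ∀ S T, S ⊆ T → u S ≤ u T := fun S T hST => by
    simp only [hu]
    by_cases hS : (S : Set V) ∈ 𝓤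
    · have hT : (T : Set V) ∈ 𝓤 := h𝓤 (Finset.coe_subset.2 hST) hS
      simp [hS, hT]
    · simp [hS]; split_ifs <;> norm_num
  have hvmono : ∀ S T, S ⊆ T → v S ≤ v T := fun S T hST => by
    simp only [hv]
    by_cases hS : (S : Set V) ∈ 𝓥
    · have hT : (T : Set V) ∈ 𝓥 := h𝓥 (Finset.coe_subset.2 hST) hS
      simp [hS, hT]
    · simp [hS]; split_ifs <;> norm_num
  -- `q` is the indicator of the fibre `h ∈ S`
  have hq_eq : ∀ S : Finset V, q S = if S ∩ {h} = {h} then 1 else 0 := fun S => by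
    simp only [hq, Set.mem_setOf_eq, Finset.mem_coe, inter_singleton_eq_singleton_iff]
  -- the probabilities as cluster-law sums
  have hexp : ∀ (A : Set (Config E)) (g : Finset V → K),
      (∀ ω, A.indicator (1 : Config E → K) ω = g (univ.filter fun x => Conn ends ω s x)) →
      prob p A = ∑ S : Finset V, w S * g S := by
    intro A g hg
    rw [prob_eq_expect_indicator]
    have : (A.indicator (1 : Config E → K)) = fun ω => g (univ.filter fun x => Conn ends ω s x) :=
      funext hg
    rw [this, CRClusterLaw.expect_of_cluster]
  have hind : ∀ (A B : Set (Config E)) (ω : Config E),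
      (A ∩ B).indicator (1 : Config E → K) ω = A.indicator 1 ω * B.indicator 1 ω := by
    intro A B ω
    by_cases hA : ω ∈ A <;> by_cases hB : ω ∈ B <;> simp [hA, hB]
  have hQ : prob p Q = ∑ S, w S * q S := by
    refine hexp _ _ fun ω => ?_
    rw [CRClusterLaw.indicator_clusterInEvent]
    simp only [hq]
    simp
  have hU : prob p U = ∑ S, w S * u S :=
    hexp _ _ fun ω => CRClusterLaw.indicator_clusterInEvent ends s 𝓤 ω
  have he : prob p e = ∑ S, w S * v S :=
    hexp _ _ fun ω => CRClusterLaw.indicator_clusterInEvent ends s 𝓥 ω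
  have hQU : prob p (Q ∩ U) = ∑ S, w S * (q S * u S) := by
    refine hexp _ _ fun ω => ?_
    rw [hind, CRClusterLaw.indicator_clusterInEvent, CRClusterLaw.indicator_clusterInEvent]
    simp only [hq, hu]
    simp
  have hQe : prob p (Q ∩ e) = ∑ S, w S * (q S * v S) := by
    refine hexp _ _ fun ω => ?_
    rw [hind, CRClusterLaw.indicator_clusterInEvent, CRClusterLaw.indicator_clusterInEvent]
    simp only [hq, hv]
    simp
  have hUe : prob p (U ∩ e) = ∑ S, w S * (u S * v S) := by
    refine hexp _ _ fun ω => ?_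
    rw [hind, CRClusterLaw.indicator_clusterInEvent, CRClusterLaw.indicator_clusterInEvent]
  have hQUe : prob p (Q ∩ U ∩ e) = ∑ S, w S * (q S * (u S * v S)) := by
    refine hexp _ _ fun ω => ?_
    rw [hind, hind, CRClusterLaw.indicator_clusterInEvent, CRClusterLaw.indicator_clusterInEvent,
      CRClusterLaw.indicator_clusterInEvent, mul_assoc]
    simp only [hq, hu, hv]
    simp
  have htot : ∑ S, w S = 1 := by
    have := hexp Set.univ (fun _ => 1) (fun ω => by simp)
    rw [prob_univ] at this
    simpa using this.symm
  -- the lattice theorem and the translation of its fibre sums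
  have key := t_principal (μ := w) hw0 hlsm hu0 hu1 humono hv0 hv1 hvmono h
  have e1 : (∑ S ∈ univ.filter (fun S => S ∩ {h} = {h}), w S) = ∑ S, w S * q S := by
    rw [sum_filter]; refine sum_congr rfl fun S _ => ?_; rw [hq_eq]; split_ifs <;> simp
  have e2 : (∑ S ∈ univ.filter (fun S => S ∩ {h} = {h}), w S * u S) = ∑ S, w S * (q S * u S) := by
    rw [sum_filter]; refine sum_congr rfl fun S _ => ?_; rw [hq_eq]; split_ifs <;> simp
  have e3 : (∑ S ∈ univ.filter (fun S => S ∩ {h} = {h}), w S * v S) = ∑ S, w S * (q S * v S) := by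
    rw [sum_filter]; refine sum_congr rfl fun S _ => ?_; rw [hq_eq]; split_ifs <;> simp
  have e4 : (∑ S ∈ univ.filter (fun S => S ∩ {h} = {h}), w S * (u S * v S))
      = ∑ S, w S * (q S * (u S * v S)) := by
    rw [sum_filter]; refine sum_congr rfl fun S _ => ?_; rw [hq_eq]; split_ifs <;> simp
  rw [e1, e2, e3, e4, htot, mul_one] at key
  rw [hQ, hU, he, hQU, hQe, hUe, hQUe]
  linarith [key]

end Percolation

section Corollaries

open scoped Classical

variable {V : Type*} {E : Type*} [Fintype V] [Fintype E]
  {K : Type*} [Field K] [LinearOrder K] [IsStrictOrderedRing K]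

/-- **(T_h) under `ClusterLogSupermod`** (the cell's hypothesis of SideCluster.lean). -/
theorem t_of_clusterLogSupermod (p : E → K) (hp : IsProbVec p) (ends : E → Sym2 V) (s h : V)
    (hlsm : ClusterLogSupermod p ends s) {𝓤 𝓥 : Set (Set V)}
    (h𝓤 : IsUpperSet 𝓤) (h𝓥 : IsUpperSet 𝓥) :
    let Q := clusterInEvent ends s {T : Set V | h ∈ T}
    let U := clusterInEvent ends s 𝓤
    let e := clusterInEvent ends s 𝓥
    prob p (Q ∩ U) * prob p e + prob p U * prob p (Q ∩ e) ≤
      prob p (Q ∩ U ∩ e) + prob p Q * prob p (U ∩ e) :=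
  t_of_clusterLaw_lsm ends s h p hp h𝓤 h𝓥 (fun S T => hlsm S T)

/-- **(T_h) on every forest.** -/
theorem t_of_isForest (p : E → K) (hp : IsProbVec p) {ends : E → Sym2 V}
    (hF : Hull.IsForest ends) (s h : V) {𝓤 𝓥 : Set (Set V)}
    (h𝓤 : IsUpperSet 𝓤) (h𝓥 : IsUpperSet 𝓥) :
    let Q := clusterInEvent ends s {T : Set V | h ∈ T}
    let U := clusterInEvent ends s 𝓤
    let e := clusterInEvent ends s 𝓥
    prob p (Q ∩ U) * prob p e + prob p U * prob p (Q ∩ e) ≤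
      prob p (Q ∩ U ∩ e) + prob p Q * prob p (U ∩ e) :=
  t_of_clusterLogSupermod p hp ends s h (ForestCluster.clusterLogSupermod_of_isForest p hp hF s)
    h𝓤 h𝓥

/-- **(T_h) on every triangular cactus built from the root.** -/
theorem t_of_isCactusFrom (p : E → K) (hp : IsProbVec p) {ends : E → Sym2 V} {s : V}
    (hC : Cactus.IsCactusFrom ends s Set.univ) (h : V) {𝓤 𝓥 : Set (Set V)}
    (h𝓤 : IsUpperSet 𝓤) (h𝓥 : IsUpperSet 𝓥) :
    let Q := clusterInEvent ends s {T : Set V | h ∈ T}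
    let U := clusterInEvent ends s 𝓤
    let e := clusterInEvent ends s 𝓥
    prob p (Q ∩ U) * prob p e + prob p U * prob p (Q ∩ e) ≤
      prob p (Q ∩ U ∩ e) + prob p Q * prob p (U ∩ e) :=
  t_of_clusterLogSupermod p hp ends s h (Cactus.clusterLogSupermod_of_isCactusFrom hp hC) h𝓤 h𝓥

end Corollaries

end TFKG

end Summit.Ventures.PercRepro2
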